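import Mathlib
import HarnessLib
import Summits.FinalStateConjecture.Statement

/-!
# Orientation kit (lead c6, crux stmt-FinalStateConjecture-13550) — the cheap way to `IsFutureOriented`

EVIDENCE ONLY.  The re-typed summit asks `Summit.FinalStateConjecture.IsFutureOriented d` of the
witnessing decomposition.  Two of its three clauses are ALREADY clauses of the route's HonestCore
predicate `Hc` (items 13549/13550/13551 of route StarvedNecks): (i) orthochronous motions = Hc (a).2.2
literally; (iii) flat `∂₀` future-directed on late flat slabs = Hc (d) (for every slab time `τ > τ₀`).
Only clause (ii) — on every truncated Kerr–Schild slab `{t*ᵢ = τ, rᵢ ≤ ρ}`, eventually in `τ`, the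
push-forward of the background's future timelike field `Λᵢ V_{Mᵢ,aᵢ}` is future-directed — is new.

`isFutureOriented_of_clauses` below (sorry-free) shows: if clause (ii) is added VERBATIM to HonestCore as
a fifth conjunct (so that the generic import G′ asserts it and `NecksCertify` transports it to `d₂`,
whose conclusion is the same `Hc` text), then `IsFutureOriented d₂` is a ten-line unpacking and the
deterministic bridge F′ of the c5 kit (`RetypeKitC5.lean`, `FutureOrientedOfSeamed`) needs no
differential-topology propagation lemma.  Deriving (ii) instead from SEAMED (5) (future-directed
`Λᵢe₀`-lines on certified tubes `R₀ ≤ r ≤ Rᵢ`) plus the structure's `C²` convergence, as c5 sketched,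
requires propagating the time-orientation of `dΨᵢ(ΛᵢV)` from the certified tube down to the horizon
`r₊ < r < R₀` and out beyond `Rᵢ(τ) + 1` along each late slab: a transverse-continuity statement for
`x ↦ (Ψᵢ x, dΨᵢ|ₓ(ΛᵢV x))` into `T𝓜` (model-space extension of the chart + `continuousOn_tangentMapWithin`,
cf. `CausalityOpennessProofs.exists_isFutureTimelikeCurveOn_Ioo`, Step 3), pointwise deviation bounds
`|(Ψᵢ^*g − g_B)(u,v)| ≤ ‖dev‖ ‖u‖ ‖v‖` from `truncDeviationCk … 0`, the Kerr–Schild identities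
`g(V,V) = −(1+2H)`, `g(V,e₀) = −1`, `‖V‖ ≤ 1 + 2H‖ℓ‖`, and a radial path inside the slab with
controlled Kerr–Schild radius — an L-sized (≈ 500–800 lines) Lean job, not the "size M" of the c5 note.
-/

open scoped Manifold ContDiff
open Filter Topology Set

noncomputable section

namespace Summit.FinalStateConjecture.FinalStateConjecture.OrientKit

open Literature.Geometry.Lorentzian

set_option linter.dupNamespace false

/-- **`IsFutureOriented` from HonestCore (a), (d) and the slab-orientation clause (ii).**
Clauses (i) and (iii) of `IsFutureOriented d` are HonestCore (a) (orthochronous part) and (d)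
(future-oriented flat chart, at every flat-domain point with `x⁰ > τ₀`, hence on every flat slab
`{x⁰ = τ}` with `τ > τ₀`); clause (ii) is taken as a hypothesis verbatim. [evidence only] -/
theorem isFutureOriented_of_clauses {𝓢 : Spacetime.{0} 4} {O : Set 𝓢.carrier} {k : ℕ}
    (d : FinalStateDecomposition 𝓢 O k)
    (ha : ∀ i, 0 < ((d.motion i).1 : E4 ≃L[ℝ] E4) (E4.basisVector 0) 0)
    (hd : ∀ y : d.flatDomain, d.τ₀ < y.1 0 →
      𝓢.timeOrientation.IsFutureDirected (mfderiv 𝓘(ℝ, E4) (𝓡 4) d.flatChart y (E4.basisVector 0)))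
    (hii : ∀ i (ρ : ℝ), ∀ᶠ τ in atTop, ∀ x ∈ (d.background i).truncTimeSlab ρ τ,
      𝓢.timeOrientation.IsFutureDirected
        (mfderiv 𝓘(ℝ, E4) (𝓡 4) (d.chart i) x
          (((d.motion i).1 : E4 ≃L[ℝ] E4)
            (Kerr.timeVector (d.mass i) (d.spin i)
              (poincareInv (d.motion i).1 (d.motion i).2 (x : E4)))))) :
    IsFutureOriented d := by
  refine ⟨ha, hii, ?_⟩
  filter_upwards [eventually_gt_atTop d.τ₀] with τ hτ
  intro x hx
  refine hd x ?_
  have hx0 : (x : E4) 0 = τ := hx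
  rw [hx0]
  exact hτ

end Summit.FinalStateConjecture.FinalStateConjecture.OrientKit

end
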